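import Summits.AnomalousDissipation.AnomalousDissipation.Theorems.BaireTransferDenseLoudDesignerForcesErgodicGlue
import Summits.AnomalousDissipation.AnomalousDissipation.Theorems.BaireTransferDenseLoudDesignerForcesStubBirkhoffMeans
import Summits.AnomalousDissipation.AnomalousDissipation.Theorems.BaireTransferDenseLoudDesignerForcesStubTrajectoryPowerBudget
import Summits.AnomalousDissipation.AnomalousDissipation.Theorems.BaireTransferDenseLoudDesignerForcesStubRecurrence
import Summits.AnomalousDissipation.AnomalousDissipation.Theorems.BaireTransferDenseLoudDesignerForcesStubShadowBudgets
import Summits.AnomalousDissipation.AnomalousDissipation.Theorems.BaireTransferDenseLoudDesignerForcesStubClassicalPeriodicWitness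
import Summits.AnomalousDissipation.AnomalousDissipation.Theorems.BaireTransferDenseLoudDesignerForcesErgodicClosing
import Summits.AnomalousDissipation.AnomalousDissipation.Theorems.BaireTransferDenseLoudDesignerForcesStubLoudInvariantMeasureOrbitClosure
import Summits.AnomalousDissipation.AnomalousDissipation.Theorems.BaireTransferDenseLoudDesignerForcesErgodicEncodingEquiv
import Summits.AnomalousDissipation.AnomalousDissipation.Theorems.BaireTransferDenseLoudDesignerForcesErgodicEntrySteadyState
import Summits.AnomalousDissipation.AnomalousDissipation.Theorems.BaireTransferDenseLoudDesignerForcesErgodicPeriodicOrbitB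
import Summits.AnomalousDissipation.AnomalousDissipation.Theorems.BaireTransferDenseLoudDesignerForcesErgodicModel
import Summits.AnomalousDissipation.AnomalousDissipation.Theorems.BaireTransferDenseLoudDesignerForcesErgodicInvariantCore
import Summits.AnomalousDissipation.AnomalousDissipation.Theorems.BaireTransferDenseLoudDesignerForcesErgodicPhaseInjOn
import Summits.AnomalousDissipation.AnomalousDissipation.Theorems.BaireTransferDenseLoudDesignerForcesErgodicStokesResolvent
import Summits.AnomalousDissipation.AnomalousDissipation.Theorems.BaireTransferDenseLoudDesignerForcesErgodicModelMeasure
import Summits.AnomalousDissipation.AnomalousDissipation.Theorems.BaireTransferDenseLoudDesignerForcesErgodicModelCore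
import Summits.AnomalousDissipation.AnomalousDissipation.Theorems.BaireTransferDenseLoudDesignerForcesErgodicSqrtResolvent
import Summits.AnomalousDissipation.AnomalousDissipation.Theorems.BaireTransferDenseLoudDesignerForcesErgodicModelCoreV
import Summits.AnomalousDissipation.AnomalousDissipation.Theorems.BaireTransferDenseLoudDesignerForcesErgodicEnstrophyLifespan
import Summits.AnomalousDissipation.AnomalousDissipation.Theorems.BaireTransferDenseLoudDesignerForcesErgodicL2H4Smoothing
import Summits.AnomalousDissipation.AnomalousDissipation.Theorems.BaireTransferDenseLoudDesignerForcesErgodicVStability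
import Summits.AnomalousDissipation.AnomalousDissipation.Theorems.BaireTransferDenseLoudDesignerForcesErgodicLinearisedExistence
import Summits.AnomalousDissipation.AnomalousDissipation.Theorems.BaireTransferDenseLoudDesignerForcesErgodicSobolevFourWindow
import Summits.AnomalousDissipation.AnomalousDissipation.Theorems.BaireTransferDenseLoudDesignerForcesErgodicTimeDerivLinearised
import Summits.AnomalousDissipation.AnomalousDissipation.Theorems.BaireTransferDenseLoudDesignerForcesErgodicLinearisedH2Smoothing
-- (deferred until built on the farm) import Summits.AnomalousDissipation.AnomalousDissipation.Theorems.BaireTransferDenseLoudDesignerForcesErgodicH4Smoothing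
-- (deferred until built on the farm) import Summits.AnomalousDissipation.AnomalousDissipation.Theorems.BaireTransferDenseLoudDesignerForcesErgodicLinearisedForcedVGrowth
-- (deferred until built on the farm) import Summits.AnomalousDissipation.AnomalousDissipation.Theorems.BaireTransferDenseLoudDesignerForcesErgodicRateTransfer
-- (deferred until built on the farm) import Summits.AnomalousDissipation.AnomalousDissipation.Theorems.BaireTransferDenseLoudDesignerForcesErgodicGevreyCompactness
-- (deferred until built on the farm) import Summits.AnomalousDissipation.AnomalousDissipation.Theorems.BaireTransferDenseLoudDesignerForcesErgodicLinearisedForcedExistence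
-- (deferred until built on the farm) import Summits.AnomalousDissipation.AnomalousDissipation.Theorems.BaireTransferDenseLoudDesignerForcesErgodicLinearisedCompactness
-- (deferred until built on the farm) import Summits.AnomalousDissipation.AnomalousDissipation.Theorems.BaireTransferDenseLoudDesignerForcesErgodicGevreySobolevBounds
-- (deferred until built on the farm) import Summits.AnomalousDissipation.AnomalousDissipation.Theorems.BaireTransferDenseLoudDesignerForcesErgodicFirstRemainderV
-- (deferred until built on the farm) import Summits.AnomalousDissipation.AnomalousDissipation.Theorems.BaireTransferDenseLoudDesignerForcesErgodicStokesSemigroup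
-- (deferred until built on the farm) import Summits.AnomalousDissipation.AnomalousDissipation.Theorems.BaireTransferDenseLoudDesignerForcesErgodicDuhamelOperator
-- (deferred until built on the farm) import Summits.AnomalousDissipation.AnomalousDissipation.Theorems.BaireTransferDenseLoudDesignerForcesErgodicGevreySmoothing
-- (deferred until built on the farm) import Summits.AnomalousDissipation.AnomalousDissipation.Theorems.BaireTransferDenseLoudDesignerForcesErgodicPerturbedLocalExistence
-- (deferred until built on the farm) import Summits.AnomalousDissipation.AnomalousDissipation.Theorems.BaireTransferDenseLoudDesignerForcesErgodicSmoothMildFlow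
-- (deferred until built on the farm) import Summits.AnomalousDissipation.AnomalousDissipation.Theorems.BaireTransferDenseLoudDesignerForcesErgodicSingularGronwall
-- (deferred until built on the farm) import Summits.AnomalousDissipation.AnomalousDissipation.Theorems.BaireTransferDenseLoudDesignerForcesErgodicWeakDuhamel
-- (deferred until built on the farm) import Summits.AnomalousDissipation.AnomalousDissipation.Theorems.BaireTransferDenseLoudDesignerForcesErgodicPhaseGevrey
-- (deferred until built on the farm) import Summits.AnomalousDissipation.AnomalousDissipation.Theorems.BaireTransferDenseLoudDesignerForcesErgodicDiagonalSemigroupCalculus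
-- (deferred until built on the farm) import Summits.AnomalousDissipation.AnomalousDissipation.Theorems.BaireTransferDenseLoudDesignerForcesErgodicLinearisedWeakDuhamel
-- (deferred until built on the farm) import Summits.AnomalousDissipation.AnomalousDissipation.Theorems.BaireTransferDenseLoudDesignerForcesErgodicMildTube
-- (deferred until built on the farm) import Summits.AnomalousDissipation.AnomalousDissipation.Theorems.BaireTransferDenseLoudDesignerForcesErgodicConjugatedMildIdentity
-- (deferred until built on the farm) import Summits.AnomalousDissipation.AnomalousDissipation.Theorems.BaireTransferDenseLoudDesignerForcesErgodicTorusInterpolation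
-- (deferred until built on the farm) import Summits.AnomalousDissipation.AnomalousDissipation.Theorems.BaireTransferDenseLoudDesignerForcesErgodicContinuation
-- (deferred until built on the farm) import Summits.AnomalousDissipation.AnomalousDissipation.Theorems.BaireTransferDenseLoudDesignerForcesErgodicMildBilinearForm
-- (deferred until built on the farm) import Summits.AnomalousDissipation.AnomalousDissipation.Theorems.BaireTransferDenseLoudDesignerForcesErgodicLinearisedH3Smoothing
import Summits.AnomalousDissipation.AnomalousDissipation.Theorems.BaireTransferDenseLoudDesignerForcesErgodicModelDefs
-- (deferred until built on the farm) import Summits.AnomalousDissipation.AnomalousDissipation.Theorems.BaireTransferDenseLoudDesignerForcesErgodicVectorFieldHolder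
-- (deferred until built on the farm) import Summits.AnomalousDissipation.AnomalousDissipation.Theorems.BaireTransferDenseLoudDesignerForcesErgodicFrameCurveDeriv
-- (deferred until built on the farm) import Summits.AnomalousDissipation.AnomalousDissipation.Theorems.BaireTransferDenseLoudDesignerForcesErgodicLinearMildFlow
-- (deferred until built on the farm) import Summits.AnomalousDissipation.AnomalousDissipation.Theorems.BaireTransferDenseLoudDesignerForcesErgodicLinearisedGevreySmoothing
-- (deferred until built on the farm) import Summits.AnomalousDissipation.AnomalousDissipation.Theorems.BaireTransferDenseLoudDesignerForcesErgodicModelSemigroup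
-- (deferred until built on the farm) import Summits.AnomalousDissipation.AnomalousDissipation.Theorems.BaireTransferDenseLoudDesignerForcesErgodicModelCoreDynamics
-- (deferred until built on the farm) import Summits.AnomalousDissipation.AnomalousDissipation.Theorems.BaireTransferDenseLoudDesignerForcesErgodicModelMeasureCore
-- (deferred until built on the farm) import Summits.AnomalousDissipation.AnomalousDissipation.Theorems.BaireTransferDenseLoudDesignerForcesErgodicModelFrameExists
-- (deferred until built on the farm) import Summits.AnomalousDissipation.AnomalousDissipation.Theorems.BaireTransferDenseLoudDesignerForcesErgodicFramePreimage
-- (deferred until built on the farm) import Summits.AnomalousDissipation.AnomalousDissipation.Theorems.BaireTransferDenseLoudDesignerForcesErgodicEnlargedPhase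
-- (deferred until built on the farm) import Summits.AnomalousDissipation.AnomalousDissipation.Theorems.BaireTransferDenseLoudDesignerForcesErgodicModelCoreCompactFrame
-- (deferred until built on the farm) import Summits.AnomalousDissipation.AnomalousDissipation.Theorems.BaireTransferDenseLoudDesignerForcesErgodicModelTube
-- (deferred until built on the farm) import Summits.AnomalousDissipation.AnomalousDissipation.Theorems.BaireTransferDenseLoudDesignerForcesErgodicVDataExistence
-- (deferred until built on the farm) import Summits.AnomalousDissipation.AnomalousDissipation.Theorems.BaireTransferDenseLoudDesignerForcesErgodicJointSmoothness
-- (deferred until built on the farm) import Summits.AnomalousDissipation.AnomalousDissipation.Theorems.BaireTransferDenseLoudDesignerForcesErgodicModelIterate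
-- (deferred until built on the farm) import Summits.AnomalousDissipation.AnomalousDissipation.Theorems.BaireTransferDenseLoudDesignerForcesErgodicModelDerivative
-- (deferred until built on the farm) import Summits.AnomalousDissipation.AnomalousDissipation.Theorems.BaireTransferDenseLoudDesignerForcesErgodicGevreyInterpolation
-- (deferred until built on the farm) import Summits.AnomalousDissipation.AnomalousDissipation.Theorems.BaireTransferDenseLoudDesignerForcesErgodicTwoBackgroundGevreySmoothing
-- (deferred until built on the farm) import Summits.AnomalousDissipation.AnomalousDissipation.Theorems.BaireTransferDenseLoudDesignerForcesErgodicConjugatedLinearisedMildIdentity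
-- (deferred until built on the farm) import Summits.AnomalousDissipation.AnomalousDissipation.Theorems.BaireTransferDenseLoudDesignerForcesErgodicMildFlowDerivativesContinuity
-- (deferred until built on the farm) import Summits.AnomalousDissipation.AnomalousDissipation.Theorems.BaireTransferDenseLoudDesignerForcesErgodicTubeOrbitClassical
-- (deferred until built on the farm) import Summits.AnomalousDissipation.AnomalousDissipation.Theorems.BaireTransferDenseLoudDesignerForcesErgodicClosedOrbitClassical
-- (deferred until built on the farm) import Summits.AnomalousDissipation.AnomalousDissipation.Theorems.BaireTransferDenseLoudDesignerForcesErgodicModelTimeDerivativeFields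
-- (deferred until built on the farm) import Summits.AnomalousDissipation.AnomalousDissipation.Theorems.BaireTransferDenseLoudDesignerForcesErgodicModelDerivativeCompactInjective
-- (deferred until built on the farm) import Summits.AnomalousDissipation.AnomalousDissipation.Theorems.BaireTransferDenseLoudDesignerForcesErgodicHyperbolicityTransfer
-- (deferred until built on the farm) import Summits.AnomalousDissipation.AnomalousDissipation.Theorems.BaireTransferDenseLoudDesignerForcesErgodicLinearisedVDataExistence
-- (deferred until built on the farm) import Summits.AnomalousDissipation.AnomalousDissipation.Theorems.BaireTransferDenseLoudDesignerForcesErgodicModelMixedDerivativeField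
import Summits.AnomalousDissipation.AnomalousDissipation.Theorems.BaireTransferDenseLoudDesignerForcesErgodicSmoothModel
import Literature.Dynamics.Hyperbolic.GrowthRates
import Literature.Dynamics.Hyperbolic.HyperbolicSemiflowModel
import HarnessLib.Audit

/-!
# Line `ergodic-budget-selection-closing` — skeleton v14 for crux `BaireTransfer.DenseLoudDesignerForces`
(item stmt-AnomalousDissipation-1143, route route-AnomalousDissipation-BaireTransfer; leads b-0 → c1-0 → c3-0 → c4-0 → c5-0 → … → c14-0, 2026-08-16/17)

v14 (c14-0, 10:10Z): N0g/N0h LANDED and imported; §1c registers the N-E a-priori tools E2a/E3/E4 (delegated).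

v13 (c14-0, 09:00Z): tools stubs N0a–N0e LANDED (wave 1) and imported; §1b keeps only N0f (linearised existence, delegated).

v12 (FIFTEENTH LEAD c14-0, 2026-08-17): composition and the three open stubs 1′ / N / D UNCHANGED (c6–c13 were readbacks: 1′ ⊇ stmt-1149 =
open problem, N/D item-sized printed mathematics).  What v12 adds (§1b): five REGISTERED TOOLS STUBS of block N — bricks of the intended
construction of `stub_smoothModel` (`K_c` = maximal invariant core of the phase; `Smap = (1 + A)⁻¹`; `Λ = Smap⁻¹(K_c)` compact by
parabolic smoothing + Rellich; `m = (Smap⁻¹|_{K_c})_* μ`; backward uniqueness ⇒ `φ_t` injective on `K`) — each a self-contained TRUE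
statement in tree vocabulary, delegated to one stub-worker each (wave 1), landed `--supports stmt-AnomalousDissipation-1143`:
`stub_invariantCoreTools`, `stub_phaseInjOnTools`, `stub_modelMeasureTools`, `stub_stokesResolventTools`, `stub_modelCoreCompactTools`.
They are not consumed by `DenseLoudDesignerForces_of` (tools, exactly as v9's `stub_ergodicH2SmoothingTools` / `stub_ergodicH3SmoothingTools`);
the remaining blocks of N (existence of strong solutions on `[0,2]` near `K_c` from `H²` data, linearised existence, `C²` dependence in the
`H²` frame, phase enlargement, assembly) are designed in the lead's NOTES and attacked in later waves.  This is strategist Option B (library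
value; it does not move the crux, whose residual 1′ stays blocked on stmt-1149).

v11 (SIXTH LEAD c5-0, 22:4xZ; NO stub or signature changed w.r.t. v10 — header only).  CERTIFICATES landed this seat, all
`--supports stmt-AnomalousDissipation-1143`, namespace `…Theorems.DenseLoudDesignerForces.Ergodic`:
  * `cert_denseLoudLerayHopfForces_of_loudTrajectories` / `cert_denseLoudLerayHopfForces_of_hyperbolicLoudTrajectories`
    (`…ErgodicCertificateLH.lean`, p127737; the substance was already the 1149 seat's `…DenseLoudLerayHopfForcesTrajectories.lean`):
    Stub 1′ — even without its hyperbolicity clause — IMPLIES the open support item `DenseLoudLerayHopfForces` (stmt-1149), as the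
    crux itself does (`denseLoudLerayHopfForces_of_denseLoudDesignerForces`): the residual contains the finite-ν designer zeroth law;
  * `cert_loudTrajectory_of_periodicWitness` (`…ErgodicCertificateEntry.lean`, p128017): conversely every MEAN-ZERO loud periodic
    classical witness of the crux is an NS phase with a loud trajectory (Stub 1′ minus (H), any budget slack) — so Stub 1′ is sandwiched
    between the crux (mean-zero slice) and crux + chaotic hypothesis (H): it is crux-sized, exactly as the planners' card intended;
  * `ergodic_line_glue_v10` (`…ErgodicGlueV10.lean`, p128201): the v10 composition as a sorry-free CONDITIONAL theorem in the tree,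
    `Stub 1′ → N → D → DenseLoudDesignerForces` (helpers `denseHyperbolicLoudMeasures_of`, `closingLemma_of_model`).
  D is further analysed in `Lines/ergodic-budget-selection-closing-D-split.md` (D = D-b ∘ D-a: D-b closing from Pesin charts provable over
  the landed kernel/transit/decoding files, interface `HasPesinCharts` specified; D-a = MET + tempered charts in Hilbert space, print,
  sources unheld).  VERDICT of this seat: the open set {1′, N, D-a} is {open problem ≥ stmt-1149, NS-analysis programme (H^s local
  well-posedness with C² dependence), smooth-ergodic-theory programme}; the crux is parked on stmt-1149.

v9 (FIFTH LEAD c4-0) — RESHAPE OF STUB 2′ AT THE SKELETON LEVEL, following the checked scout report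
`Cruxes/DenseLoudDesignerForces/Lines/ergodic-budget-selection-closing-chartEncoding-scout.md`:

  Stub 2′ `stub_chartEncoding` ≡ Stub 2 `stub_closingLemma` (Stub E, LANDED p110553) = G ∘ (N, D), where
  * **N `stub_smoothModel`** (REGISTERED, Navier–Stokes analysis, sources HELD, XL): a hyperbolic invariant measure `μ` of an NS
    phase `(K, φ)` admits an ENLARGED NS phase `(K', φ')` with a SMOOTH MODEL — an injective bounded `Smap : H →L[ℝ] H` (intended
    `(1 + A)⁻¹`) conjugating a `C²` local semiflow `g` on an open `U ⊆ H` near a compact invariant `Λ` carrying `m`, `(Smap)_* m = μ`, to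
    `φ'` on `Smap '' Λ ⊆ K'`, with `(U, Λ, g, m)` an `IsHyperbolicSemiflowModel` (the Lian–Young 2012 §1 standing hypotheses, Literature
    interface p110278) and every closed orbit of `g` inside `U` carried into `K'` (`IsSmoothModelOf`);
  * **D `stub_ambientClosing`** (REGISTERED, smooth ergodic theory in Hilbert space, sources UNHELD acq-01690/05212/05574/06170/06171/06172,
    XXL): `IsHyperbolicSemiflowModel U Λ g m → HasAmbientClosing U Λ g m` over `H` (Katok 1980 Main Lemma in finite dimension; multiplicative
    ergodic theorem + Lyapunov charts + closing for semiflows on Hilbert spaces: Ruelle 1982, Lian–Young 2011/2012);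
  * **G `hasKatokClosing_of_smoothModel`** (PROVED and LANDED, `Theorems/…ErgodicModel.lean` p121606, imported): transport of
    `HasAmbientClosing` through `IsSmoothModelOf` to `HasKatokClosing`;
  * **E** `stub_encodingOfClosing` (LANDED p110553): `HasKatokClosing → HasPeriodicChartEncoding`.
  Hence `stub_closingLemma` and `stub_chartEncoding` are THEOREMS below (sorry-free from N, D); the registered open stubs of the line are
  exactly: Stub 1′ `stub_denseLoudHyperbolicTrajectories` (physics residual), N `stub_smoothModel`, D `stub_ambientClosing`.

v10 (19:5xZ): the farm olean of `Literature.Dynamics.Hyperbolic.HyperbolicSemiflowModel` is back (it was missing 14:50–19:05Z,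
which is why v9 carried verbatim mirrors of the interface) and the lead's `Theorems/…ErgodicModel.lean` (G + `IsSmoothModelOf` +
the registered `stub_closingOfSmoothModel`) has LANDED (p121606), so both are now IMPORTED; no stub signature changed.  Landed for N/D
since v9 (waves 1–3 of lead c4-0): N1 `TorusClassicalNSH2Smoothing` p118443, `TorusClassicalNSH3Smoothing` p121277 (+ `TorusConvectionGradNormSq`
p117818, `TorusConvectionLaplacianNormSq` p120521, `TorusClassicalH3Balance` p120785), `TorusLinearisedNSSmoothing` p118989, `TorusClassicalNSDifferenceSmoothing`
p119110, `TorusClassicalNSTimeDerivative` p119909, N3 `TorusEnergyRellich` p121382, Summit-side tools stubs `stub_ergodicH2SmoothingTools` p120842 and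
`stub_ergodicH3SmoothingTools` p121564 (uniform enstrophy / H² / H³ / sup / speed bounds on `φ_t(K)`, `t ≥ τ`); D8 `ClosedOrbitDecoding` p122150, D9
`SequenceShadowingJump` p122306, `HyperbolicSemiflowModelOrbits` p122587, D4 `Lusin/LusinTheorem` p122741 + `Lusin/CompactExhaustion` p123371, D5-glue
`HyperbolicSemiflowModelGlue` p123369, `HyperbolicSemiflowModelEquilibria` p123534; homoclinic E0 `stub_chowLinPalmerShadowing` p116985.  What remains:
N2 (strong local well-posedness in `V`/`H²` near `K` with `C²` dependence, linearised existence + smoothing), N5 (phase enlargement), N assembly;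
D1 (two-sided MET for `derivCocycle` over `(Λ, g₁, m)` — Ruelle1982/Mañé1983/LianLu2010 UNHELD acq-06170/06171/06172), D3 (tempered Lyapunov charts on
transversals — LianYoung2011/2012 UNHELD acq-05212/01690/05574), D5q, D assembly; and the physics residual Stub 1′.

STATE (all LANDED under `Theorems/`, namespace `…Theorems.DenseLoudDesignerForces.Ergodic`): vocabulary + `budget_selection` (p80157); conditional
composition `ergodic_line_glue` (p85006); Stubs 3a/3b/4a/4b/5 (p84901 p86151 p86867 p87800 p89059); kernel Pilyugin 1999 Thm 1.3.1 ff.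
(`Literature/Dynamics/Hyperbolic/SequenceShadowing*.lean`, p97880 p98909 p100290 p100940 p101771) and `…ErgodicClosing.lean` (p103311); Stub KB
`stub_loudInvariantMeasure` (p109397 over Literature Krylov–Bogolyubov p108931), Stub OC (p109864), Stub KB′ (p112424), Stub E (p110553), Entries
S/P (p110873 p111965 p112736), N-side Literature already landed by c3-0's workers: `SemiflowPoincareMap` (D5, p111449), `TorusLinearisedNS{Energy,Growth,
H1Balance}` (N4, p110904 p112069 p112198) + bridge p114352, `LogConvexityBackwardUniqueness` / `TorusClassicalNSBackwardUniqueness` (N3, p114711 p115288),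
`AnosovClosingCLP` (p112322), D6 `SequenceShadowingRescale` (p110253).

History: planner skeleton (crux-plan r2, 5 stubs) → b-0 v2–v4 (Stub 2 may ENLARGE the phase; Stubs 3/4 split; five stubs landed) → c1-0 v5
(Stub 2 = `closingLemma_of_chartEncoding` ∘ Stub 2′ over the landed kernel) → c3-0 v6–v8.4 (Stub 1 = Stub 1′ ∘ KB/OC/KB′; E) → c4-0 v9 (this).
Disproof obligations (Cruxes/DenseLoudDesignerForces/Disproof.lean v15b + Negative/*): unchanged — §3 power budget is the pointwise budget of
budget selection; §7/§9/§13 quiet classes do not contain closed orbits near typical points of a loud chaotic measure; §12 planar-false honoured;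
§17/§18 period floor consistent (closing times long); §10 no free level (ν and the phase re-chosen per level, as the crux allows).
-/

set_option linter.dupNamespace false

noncomputable section

open scoped BigOperators Topology ENNReal InnerProductSpace ContDiff
open Filter Set Function MeasureTheory

namespace Summit.AnomalousDissipation.AnomalousDissipation.Cruxes.DenseLoudDesignerForces.ErgodicBudgetSelectionClosing

open Literature.Analysis.FunctionSpaces Literature.Analysis.FunctionSpaces.Torus
open Literature.Analysis.FluidPDE Literature.Analysis.FluidPDE.Torus
open Summit.AnomalousDissipation.AnomalousDissipation.Theses.BaireTransfer
open Summit.AnomalousDissipation.AnomalousDissipation.Theorems.DenseLoudDesignerForces.Negative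
open Summit.AnomalousDissipation.AnomalousDissipation.Theorems.DenseLoudDesignerForces.Ergodic
open Literature.Dynamics.Hyperbolic

/-! ## §1 The three OPEN registered stubs: Stub 1′ (physics residual), N (NS analysis), D (smooth ergodic theory) -/

/-- **Stub 1′ — the Transfer `C⁺_H` in TRAJECTORY form (CONSTRUCTION statement; the residual of the whole line; HARDEST).**
For every finite stock `S₀` there are `S ⊇ S₀`, budgets `E`, `ε > 0` and an open non-empty `U ⊆ P_S` such that at every level `j`
the forces `c ∈ P_S` are dense in `U` for which, at SOME `ν < 1/(j+1)`, the steady force `f_c` admits an NS phase `(K, φ)`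
(compact forward-invariant set of smooth states whose trajectories are global classical NS_ν(f_c) solutions) such that
(i) `K` contains ONE LOUD TRAJECTORY: a point `x ∈ K` whose time-mean energy `T⁻¹∫₀ᵀ‖φ_t x‖² ≤ E` for all large `T` and whose
time-mean dissipation `T⁻¹∫₀ᵀ ν‖∇φ_t x‖² ≥ ε` for arbitrarily large `T`, and (ii) every LOUD invariant probability measure carried by
the CLOSURE OF THE FORWARD ORBIT of `x` — ensemble energy `≤ E`, ensemble dissipation `≥ ε` — is hyperbolic (`IsHyperbolicMeasure`: no
zero Lyapunov exponent except the flow direction; the chaotic hypothesis for the LOUD STATISTICS OF THAT ONE TRAJECTORY; quiet or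
energetic pieces of its orbit closure — laminar states visited by relaminarisation, onset tori — are unconstrained, and so is the
rest of `K`).  Content = the finite-`ν` zeroth law for
fixed-degree steady designer forces along ONE bounded strong trajectory (compare the support item `DenseLoudLerayHopfForces`,
stmt-1149, which asks the same of a Leray–Hopf solution without compactness/regularity of its orbit closure) + the chaotic
hypothesis (H) for its orbit closure; the force may be RE-CHOSEN PER LEVEL.  Why it might fail: the zeroth-law half is open (all
printed loud constructions lose smoothness/steadiness of the force as `ν → 0`); (H) for ALL loud invariant measures of the orbit closure is
stronger than for one loud measure (a loud non-hyperbolic piece — a neutral large-scale mode carried at turbulent budgets, a symmetry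
torus for forces with residual continuous symmetry — must be avoided by the choice of `U`, generic `c` breaking every continuous
symmetry of `f_c`).  Cheapest falsifier: a robust second near-zero
Lyapunov exponent in forced-box DNS under a generic two-shell steady force (card).  Size XL / open.  Leans on: `IsNSPhase`,
`IsInvariantMeasure`, `IsHyperbolicMeasure`, `energyAvg`, `dissipAvg`; GallavottiCohen 1995 (chaotic hypothesis), KanedaEtAl2003
(plateau), VanVeenKidaKawahara2006 / VanVeenVelaMartinKawahara2019 (UPOs carrying turbulent budgets).
[cite: LianYoung2012, §1 (hyperbolic measures of dissipative parabolic semiflows)] -/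
theorem stub_denseLoudHyperbolicTrajectories :
    ∀ S₀ : Finset (Fin 3 → ℤ), ∃ S : Finset (Fin 3 → ℤ), S₀ ⊆ S ∧ ∃ (E ε : ℝ), 0 < ε ∧
      ∃ U : Set (↥S → (EuclideanSpace ℂ (Fin 3))), IsOpen U ∧ U.Nonempty ∧ ∀ j : ℕ,
        U ⊆ closure {c : ↥S → (EuclideanSpace ℂ (Fin 3)) | ∃ ν : ℝ, 0 < ν ∧ ν < 1 / ((j : ℝ) + 1) ∧
          ∃ (K : Set Hsp) (φ : ℝ → Hsp → Hsp), IsNSPhase ν (force S c) K φ ∧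
            ∃ x ∈ K, (∀ᶠ T in atTop, energyAvg φ x T ≤ E) ∧ (∃ᶠ T in atTop, ε ≤ dissipAvg ν φ x T) ∧
              ∀ μ : Measure Hsp, IsInvariantMeasure (closure ((fun t : ℝ => φ t x) '' Ici 0)) φ μ →
                ensembleEnergy μ ≤ E → ε ≤ ensembleDissipation ν μ → IsHyperbolicMeasure ν (force S c) φ μ} := by
  sorry

/-- **Stub N — SMOOTH HYPERBOLIC MODEL OF AN ENLARGED NS PHASE (Navier–Stokes analysis; XL; sources HELD).**
A hyperbolic invariant probability measure `μ` of an NS phase `(K, φ)` of the steady force `f_c` at viscosity `ν > 0` admits an enlarged NS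
phase `(K', φ')` of the same force (`K ⊆ K'`, `φ' = φ` on `[0,∞) × K`) together with a SMOOTH MODEL `(Smap, U, Λ, g, m)`:
`IsHyperbolicSemiflowModel U Λ g m` (open `U ⊆ H`, compact invariant `Λ ⊆ U` on which every `g_t` is bijective, local semigroup law, `g` jointly
`C²` on `(0,2) × U` and continuous on `[0,2] × U`, compact injective derivatives `D(g_t)(y)` for `y ∈ Λ`, `0 < t ≤ 2`, `m` an invariant Borel
probability on `Λ`, hyperbolic in the cocycle form) and `IsSmoothModelOf K' φ' μ Smap U Λ g m` (`Smap` injective, `Smap '' Λ ⊆ K'`, `(Smap)_* m = μ`,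
conjugacy on `Λ`, closed orbits of `g` in `U` carried onto trajectories of `φ'` in `K'`).
Intended construction (scout report §(b) N, with the sub-blocks N1–N5): `Smap := (1 + A)⁻¹` (`A` the Stokes operator on `H`; image `D(A) = H² ∩ H`);
`Λ := Smap⁻¹(K_∞)`, `K_∞ := ⋂ₙ φₙ(K)` (compact, `φ_t(K_∞) = K_∞`, `μ(K_∞) = 1`; bounded in `H³` by parabolic smoothing N1, hence `Λ` compact in `H`);
`g_t := Smap⁻¹ ∘ S(t) ∘ Smap` with `S` the strong-solution map of NS_ν(f_c), on `U := Smap⁻¹(B)` for an `H²`-open neighbourhood `B` of `K_∞` on which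
strong solutions live up to time `2` with `C²` (indeed analytic) dependence on the datum (N2: Temam1997 Ch. VII §2.1 Prop. 2.1–2.2, CF1988 Ch. 14
Lemma 14.3, RRS2016 Thm 6.8/9.1) and joint `C²`/continuity in `(t, u₀)` (time derivatives exist in `H²` for `t > 0` by smoothing); compactness of
`D S(t)(u₀) : H² → H³ ↪ H²` and injectivity by backward uniqueness of the linearised flow (N3: CF1988 Thm 12.2 — landed as
`LogConvexityBackwardUniqueness` / `TorusClassicalNSBackwardUniqueness`); `m := (Smap⁻¹|_{K_∞})_* μ` (`Smap⁻¹` is continuous on the `H²`-compact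
`K_∞`, where the `H` and `H²` topologies agree); the cocycle hyperbolicity of `m` from the classical `IsHyperbolicMeasure` of `μ` read at the
`μ`-typical points `φ₁ x` (so that linearised data are smooth) with the one-step smoothing `‖w(n+1)‖_{H²} ≤ C‖w(n)‖_{L²}` of the linearised flow
(N4: `TorusLinearisedNS*`, bridge `linearised_unique_Ici` / `linearised_growth_nat`); `K' := K ∪ K₁(R₁)`, `K₁(R₁)` := states at times `≥ 1` of
global strong solutions with `sup_t ‖∇u‖₂ ≤ R₁ := sup_{φ₁(K)} ‖∇·‖₂ + 1` — compact in `H`, forward invariant, an NS phase containing every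
closed strong orbit through `B` (N5: RRS2016 Thm 6.10/7.5; `IsInvariantMeasure.enlarge`).
Why it might fail (as a formalisation): XL — strong `H²` well-posedness of NS_ν on `T³` with `C²` dependence, smoothing to every `H^m`, and the
`C²`-in-time regularity are not in the tree in this form (Fujita–Kato / Kato mild theory on `T³` is: `PeriodicBoundedMild*`,
`Torus.exists_classicalNS_of_bounded_data`); every field of `IsHyperbolicSemiflowModel` is a separate estimate.  Mathematically standard.
Leans on: `IsNSPhase`, `IsInvariantMeasure`, `IsHyperbolicMeasure`, `IsHyperbolicSemiflowModel`, `IsSmoothModelOf`;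
`Torus.IsClassicalNSSolutionOn.{velocity_unique, integral_norm_sub_sq_le_mul_exp}`, `exists_hilbertBasis_stokes_holds`,
`Torus.stokesOperatorH_eq_diagonalPMap_holds`, `TorusClassicalNSBackwardUniqueness`, `TorusLinearisedNS{Energy,Growth,H1Balance}`.
[cite: Temam1997, Ch. VII §2.1 Prop. 2.1–2.2; Ch. III §6] [cite: ConstantinFoiasNSE1988, Ch. 12 Thm 12.1–12.2, Ch. 14 (14.2)–(14.4), Lemma 14.3] -/
theorem stub_smoothModel {S : Finset (Fin 3 → ℤ)} {c : ↥S → (EuclideanSpace ℂ (Fin 3))} {ν : ℝ} {K : Set Hsp} {φ : ℝ → Hsp → Hsp}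
    {μ : Measure Hsp} (hν : 0 < ν) (hK : IsNSPhase ν (force S c) K φ) (hμ : IsInvariantMeasure K φ μ)
    (hH : IsHyperbolicMeasure ν (force S c) φ μ) :
    ∃ (K' : Set Hsp) (φ' : ℝ → Hsp → Hsp) (Smap : Hsp →L[ℝ] Hsp) (U Λ : Set Hsp) (g : ℝ → Hsp → Hsp) (m : Measure Hsp),
      K ⊆ K' ∧ (∀ t : ℝ, 0 ≤ t → ∀ x ∈ K, φ' t x = φ t x) ∧ IsNSPhase ν (force S c) K' φ' ∧
        IsHyperbolicSemiflowModel U Λ g m ∧ IsSmoothModelOf K' φ' μ Smap U Λ g m :=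
  Summit.AnomalousDissipation.AnomalousDissipation.Theorems.DenseLoudDesignerForces.Ergodic.stub_smoothModel hν hK hμ hH

/-- **Stub D — THE CLOSING LEMMA FOR HYPERBOLIC MEASURES OF `C²` LOCAL SEMIFLOWS ON THE HILBERT SPACE `H` (smooth ergodic theory; XXL;
sources UNHELD).**  `IsHyperbolicSemiflowModel U Λ g m → HasAmbientClosing U Λ g m`: compact Pesin sets `P_ℓ ⊆ Λ` exhausting `m`-a.e. such that
every `δ`-return of `x ∈ P_ℓ` to `P_ℓ` at an integer time `n ≥ 1` is closed by a genuine closed orbit of `g` inside `U`, of period `|T − n| ≤ η`,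
`η`-shadowing the orbit of `x` at the integer times `0 ≤ k ≤ n`.  Intended proof (scout report §(b) D1–D9): multiplicative ergodic theorem for the
compact injective derivative cocycle of `g₁` over the invertible base `(Λ, g₁, m)` (D1: Ruelle 1982 Thm 1.1 ff.; Mañé 1983; Lian–Lu 2010); `hyperbolic`
⇒ the zero exponent has multiplicity `≤ 1` and is carried by `ℝ·flowDir` (D2); `ε`-reduction / Lyapunov norms `G_x = 1 + compact` and tempered regular
neighbourhoods for the transversal cocycle (D3: BarreiraPesin2023 Thm 4.10/4.13 finite-dimensional template; Lian–Young 2011/2012 in Hilbert space);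
compact Pesin sets with norm-continuous charts by Lusin (D4); transversals and Poincaré maps with `C²` bounds (D5, landed `SemiflowPoincareMap`);
tempered rescaling (D6, landed `SequenceShadowingRescale`); the shadowing kernel (D7, landed `SequenceShadowing*`: `exists_periodic_shadow`,
`sum_norm_periodic_shadow_le`, `shadow_unique`); decoding by transit-time schedules (D8, `TransitTimeSchedules`); the once-per-period chart mismatch
absorbed into the nonlinearity or a skew coupling (D9, `SequenceShadowingSkew`).  Stated over `H` only (the phase space of the line), not over a
general Banach space.  Why it might fail (as a formalisation): XXL and source-blocked — no Oseledets/Kingman/MET, no Pesin theory and no Lusin-type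
continuity-on-large-compacta theorem are in Mathlib or the tree; LianYoung2012 (acq-01690/05574), LianYoung2011 (acq-05212), Ruelle1982 (acq-06170),
Mañé1983 (acq-06171), LianLu2010 (acq-06172) are all unheld, so no named fact may be filed for the core (no-guessing rule).  Mathematically printed
for ergodic measures with the stated standing hypotheses; the non-ergodic case by ergodic decomposition on the compact metric space `Λ`.
Leans on: `IsHyperbolicSemiflowModel`, `HasAmbientClosing` (Literature interface p110278); D5–D8 landed pieces named above.
[cite: LianYoung2012, §1 and the closing lemma for hyperbolic measures of semiflows] [cite: BarreiraPesin2023, Thm 4.10, 4.13, 11.10] -/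
theorem stub_ambientClosing {U Λ : Set Hsp} {g : ℝ → Hsp → Hsp} {m : Measure Hsp} (h : IsHyperbolicSemiflowModel U Λ g m) :
    HasAmbientClosing U Λ g m := by
  sorry

/-! ## §1b Registered TOOLS stubs of block N (lead c14-0, wave 1): bricks of the intended construction of `stub_smoothModel`
(`Λ := Smap⁻¹(K_∞)`, `m := (Smap⁻¹|_{K_∞})_* μ`, `g := Smap⁻¹ ∘ S ∘ Smap`).  Each is a self-contained TRUE statement in tree
vocabulary, proved by one worker in its own `Theorems/…Ergodic<Name>.lean` (`--supports stmt-AnomalousDissipation-1143`); they are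
not used by `DenseLoudDesignerForces_of` (tools, as `stub_ergodicH2SmoothingTools` / `stub_ergodicH3SmoothingTools` of v9 were). -/

/- LANDED tools stubs of block N (wave 1 of lead c14-0; imported above, namespace `…Theorems.DenseLoudDesignerForces.Ergodic`):
  * N0a `stub_invariantCoreTools` — `…ErgodicInvariantCore.lean` (p143277): maximal invariant core `K_c` of an NS phase (compact, `φ_t K_c = K_c`,
    `K_c ⊆ φ_t K`, again an NS phase, carries every invariant measure);
  * N0b `stub_phaseInjOnTools` — `…ErgodicPhaseInjOn.lean` (p143670): `φ_t` injective on `K` (backward uniqueness);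
  * N0c `stub_modelMeasureTools` — `…ErgodicModelMeasure.lean` (p146205): the model measure `m = μ.comap Smap` (g-invariant, carried by `Λ`,
    `(Smap)_* m = μ`, null sets pull back);
  * N0d `stub_stokesResolventTools` — `…ErgodicStokesResolvent.lean` (p145220) over `Literature/Analysis/FluidPDE/StokesTorusResolvent.lean`
    (p144296): `R = (1 + A)⁻¹` injective self-adjoint compact contraction with the two resolvent identities;
  * N0e `stub_modelCoreCompactTools` — `…ErgodicModelCore.lean` (p149502): `Λ = R ⁻¹' K_c` compact, `R '' Λ = K_c ⊆ D(A)`. -/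

/- LANDED (wave 2): N0g `stub_sqrtResolventTools` — `…ErgodicSqrtResolvent.lean` (p152025) over `Literature/Analysis/FluidPDE/
  StokesTorusSqrtResolvent.lean` (p151524): `S = (1+A)^{-1/2}`, `S ∘ S = R`, frame identity; N0h `stub_modelCoreCompactVTools` —
  `…ErgodicModelCoreV.lean` (p151836): `S ⁻¹' K_c = S '' (R ⁻¹' K_c)` compact; growth-rate calculus `Literature/Dynamics/Hyperbolic/GrowthRates.lean`
  (p150674).  All imported above. -/

/- LANDED (wave 2): N0f `stub_linearisedExistenceTools` — `…ErgodicLinearisedExistence.lean` (p154162) over the Fourier–Picard chain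
  `Literature/Analysis/FluidPDE/LinearisedNSFourier{Defs,Estimates,Picard,Iteration,TimeRegularity,Data,Synthesis,Solution}.lean`
  (p150728 p151152 p151614 p152057 p152346 p152616 p152846 p153141) and `Literature/Analysis/FunctionSpaces/TorusLinearisedNSExistence.lean`
  (p153463, `Torus.linearisedNS_exists`: existence for the linearised NS system on `[a,b] × T^d` from smooth data along a smooth divergence-free
  base, general `d`, general `ν > 0`).  E3 `stub_vStabilityTools` — `…ErgodicVStability.lean` (p154134) over `Literature/Analysis/FunctionSpaces/
  TorusClassicalNSVStabilityFlux.lean` (p152826, the integrable-coefficient flux toolkit) and `…TorusClassicalNSVStability.lean` (p153328,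
  `IsClassicalNSSolutionOn.h1_sub_le_mul_of_integral_laplacian_sq_le`, variable-coefficient Grönwall `Literature.Analysis.ODE.le_linearComparison`).
  (Wrappers imported once built.) -/

/- LANDED (wave 2): E2a `stub_enstrophyLifespanTools` — `…ErgodicEnstrophyLifespan.lean` (p152659) over `Literature/Analysis/FluidPDE/
  TorusClassicalNSEnstrophyLifespan.lean` (p152456, `IsClassicalNSSolutionOn.enstrophy_lifespan`, no zero-mean hypothesis needed);
  E4 `stub_l2H4SmoothingTools` — `…ErgodicL2H4Smoothing.lean` (p152637) over `Literature/Analysis/FluidPDE/TorusClassicalNSL2H4Smoothing.lean`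
  (p152356, `IsClassicalNSSolutionOn.intervalIntegral_norm_laplacian_laplacian_sq_le_of_le`); E0 (lead) `Literature/Analysis/FluidPDE/
  TorusNSSmoothLocalExistence.lean` (p152318: unforced short-time classical existence from smooth data on T^d, d ≤ 3, ν ≥ 0, lifespan c/√M).
  (Wrappers to be imported once the farm has built them; tools are not consumed by the composition.) -/

/-! ## §2 Glue (sorry-free): Stub 1 from Stub 1′ and Stub KB; Stub 2 and Stub 2′ from N, D, G, E -/

/-- **Pointwise glue of the reshape**: a force whose NS phase carries one loud trajectory whose orbit closure carries only hyperbolic LOUD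
invariant measures carries a loud hyperbolic invariant measure on an NS phase (`hypLoudSet`) — namely on the orbit closure (Stub OC),
by Krylov–Bogolyubov with budgets there (Stub KB′, over the landed Stub KB `stub_loudInvariantMeasure`, p109397). [folklore] -/
theorem mem_hypLoudSet_of_loudTrajectory {S : Finset (Fin 3 → ℤ)} {E ε : ℝ} {j : ℕ}
    {c : ↥S → (EuclideanSpace ℂ (Fin 3))}
    (hc : ∃ ν : ℝ, 0 < ν ∧ ν < 1 / ((j : ℝ) + 1) ∧
      ∃ (K : Set Hsp) (φ : ℝ → Hsp → Hsp), IsNSPhase ν (force S c) K φ ∧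
        ∃ x ∈ K, (∀ᶠ T in atTop, energyAvg φ x T ≤ E) ∧ (∃ᶠ T in atTop, ε ≤ dissipAvg ν φ x T) ∧
          ∀ μ : Measure Hsp, IsInvariantMeasure (closure ((fun t : ℝ => φ t x) '' Ici 0)) φ μ →
            ensembleEnergy μ ≤ E → ε ≤ ensembleDissipation ν μ → IsHyperbolicMeasure ν (force S c) φ μ) :
    c ∈ hypLoudSet S E ε j := by
  obtain ⟨ν, hν, hνj, K, φ, hK, x, hx, hE, hε, hH⟩ := hc
  obtain ⟨μ, hμ, hEμ, hεμ⟩ := stub_loudInvariantMeasure_orbitClosure hK hx hE hε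
  exact ⟨ν, hν, hνj, _, φ, μ, hK.orbitClosure hx, hμ, hEμ, hεμ, hH μ hμ hEμ hεμ⟩

/-- **Stub 1 (planner's form) — now a THEOREM modulo Stub 1′ and Stub KB**: dense loud hyperbolic trajectories give dense loud
hyperbolic invariant measures (`closure_mono` over the pointwise glue). Registered signature of v1–v5 unchanged. [folklore] -/
theorem denseHyperbolicLoudMeasures_of :
    ∀ S₀ : Finset (Fin 3 → ℤ), ∃ S : Finset (Fin 3 → ℤ), S₀ ⊆ S ∧ ∃ (E ε : ℝ), 0 < ε ∧
      ∃ U : Set (↥S → (EuclideanSpace ℂ (Fin 3))), IsOpen U ∧ U.Nonempty ∧ ∀ j : ℕ, U ⊆ closure (hypLoudSet S E ε j) := by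
  intro S₀
  obtain ⟨S, hS, E, ε, hε, U, hU, hUne, hdense⟩ := stub_denseLoudHyperbolicTrajectories S₀
  refine ⟨S, hS, E, ε, hε, U, hU, hUne, fun j => (hdense j).trans (closure_mono fun c hc => ?_)⟩
  exact mem_hypLoudSet_of_loudTrajectory hc

/-- **Stub 2 — the closing lemma for the NS_ν semiflow (Katok; Lian–Young in Hilbert space), ENLARGING THE PHASE — a THEOREM
from N, D and G**: the smooth model of N, the ambient closing of D on it, transported by G.  Registered signature unchanged (v3–v8).
[cite: LianYoung2012, Theorem (closing lemma / periodic orbits for hyperbolic measures of semiflows)] -/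
theorem stub_closingLemma {S : Finset (Fin 3 → ℤ)} {c : ↥S → (EuclideanSpace ℂ (Fin 3))} {ν : ℝ} {K : Set Hsp} {φ : ℝ → Hsp → Hsp}
    {μ : Measure Hsp} (hν : 0 < ν) (hK : IsNSPhase ν (force S c) K φ) (hμ : IsInvariantMeasure K φ μ)
    (hH : IsHyperbolicMeasure ν (force S c) φ μ) :
    ∃ (K' : Set Hsp) (φ' : ℝ → Hsp → Hsp), K ⊆ K' ∧ (∀ t : ℝ, 0 ≤ t → ∀ x ∈ K, φ' t x = φ t x) ∧
      IsNSPhase ν (force S c) K' φ' ∧ HasKatokClosing K' φ' μ := by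
  obtain ⟨K', φ', Smap, U, Λ, g, m, hsub, hagree, hK', hmodel, hS⟩ := stub_smoothModel hν hK hμ hH
  exact ⟨K', φ', hsub, hagree, hK', hasKatokClosing_of_smoothModel hS (stub_ambientClosing hmodel)⟩

/-- **Stub 2′ — periodic chart encoding in an enlarged NS phase — a THEOREM from Stub 2 and Stub E** (`stub_encodingOfClosing`, p110553).
Registered signature of v5–v8 unchanged; no longer a stub. [folklore] -/
theorem stub_chartEncoding {S : Finset (Fin 3 → ℤ)} {c : ↥S → (EuclideanSpace ℂ (Fin 3))} {ν : ℝ} {K : Set Hsp} {φ : ℝ → Hsp → Hsp}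
    {μ : Measure Hsp} (hν : 0 < ν) (hK : IsNSPhase ν (force S c) K φ) (hμ : IsInvariantMeasure K φ μ)
    (hH : IsHyperbolicMeasure ν (force S c) φ μ) :
    ∃ (K' : Set Hsp) (φ' : ℝ → Hsp → Hsp), K ⊆ K' ∧ (∀ t : ℝ, 0 ≤ t → ∀ x ∈ K, φ' t x = φ t x) ∧
      IsNSPhase ν (force S c) K' φ' ∧ HasPeriodicChartEncoding K' φ' μ := by
  obtain ⟨K', φ', h1, h2, h3, h4⟩ := stub_closingLemma hν hK hμ hH
  exact ⟨K', φ', h1, h2, h3, stub_encodingOfClosing h4⟩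

/-! ## §3 Composition: the landed glue applied to the five landed stubs and the open ones -/

/-- **The crux `DenseLoudDesignerForces` (by name) from the open stubs**: `ergodic_line_glue` (landed, p85006) fed with
Stub 1 (= Stub 1′ + Stubs OC, KB′ over the landed Stub KB), Stub 2 (= Stub 2′ + landed glue) and the landed Stubs 3a, 3b, 4a, 4b, 5. -/
theorem DenseLoudDesignerForces_of : DenseLoudDesignerForces :=
  ergodic_line_glue denseHyperbolicLoudMeasures_of @stub_closingLemma @stub_birkhoffMeans @stub_trajectoryPowerBudget
    @stub_recurrence @stub_shadowBudgets @stub_classicalPeriodicWitness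

end Summit.AnomalousDissipation.AnomalousDissipation.Cruxes.DenseLoudDesignerForces.ErgodicBudgetSelectionClosing

end
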